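import Mathlib
import Literature.AlgebraicGeometry.Resolution.AffineDomainDimension
import Literature.RingTheory.KrullDimension.FibreDimension

/-!
# TropicalLinks / SchonResolves — a principal localization of an affine domain keeps the dimension

Route `ResolutionOfSingularities/TropicalLinks`, crux `SchonResolves` (stmt-ResolutionOfSingularities-17234),
line `zariski-toric-closure`, stub DIM-aux2: the Gröbner family is realised as the affine domain
`A_t := k[ℕ × M] ⧸ (J̃ ∩ k[ℕ × M])`, whose localization away from `t̄` is the affine domain
`k[ℤ × M] ⧸ J̃` of known dimension; this stub transfers the dimension back to `A_t`.

* `schonResolves_ringKrullDim_away_eq_of_finiteType` (DIM-aux2) — for a domain `A` of finite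
  type over a field `k`, `0 ≠ x ∈ A` and any localization `L = A[1/x]`, `dim L = dim A`.

Proof: `L` is a domain, of finite type and algebraic over `A`, so `trdeg_k L = trdeg_k A`
(tower law), and `dim = trdeg_k` for affine domains (Matsumura, *Commutative Ring Theory*,
Thm. 5.6; Kemper, *A Course in Commutative Algebra*, Ch. 5).  All of this is the tree lemma
`Literature.RingTheory.KrullDimension.ringKrullDim_away_eq`; the only work here is to equip the
abstract localization `L` with its composite `k`-algebra structure.  No new definitions.
-/

-- single-problem summit: the doubled namespace component `ResolutionOfSingularities` is forced
set_option linter.dupNamespace false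

namespace Summit.ResolutionOfSingularities.ResolutionOfSingularities.Theorems

/-- **A nonzero principal localization of an affine domain has the same dimension** (DIM-aux2):
for a domain `A` of finite type over a field `k`, `x ≠ 0` in `A` and any localization `L` of `A`
away from `x`, `dim L = dim A` (both equal `trdeg_k` of the common fraction field).
[cite: Matsumura1987, §5 Thm. 5.6] -/
theorem schonResolves_ringKrullDim_away_eq_of_finiteType : ∀ (k : Type) [Field k] (A : Type)
    [CommRing A] [IsDomain A] [Algebra k A] [Algebra.FiniteType k A] (x : A), x ≠ 0 →
      ∀ (L : Type) [CommRing L] [Algebra A L] [IsLocalization.Away x L],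
        ringKrullDim L = ringKrullDim A := by
  intro k _ A _ _ _ _ x hx L _ _ _
  -- the composite `k → A → L` makes `L` a `k`-algebra with `IsScalarTower k A L`
  letI : Algebra k L := ((algebraMap A L).comp (algebraMap k A)).toAlgebra
  haveI : IsScalarTower k A L := IsScalarTower.of_algebraMap_eq' rfl
  exact Literature.RingTheory.KrullDimension.ringKrullDim_away_eq k hx L

end Summit.ResolutionOfSingularities.ResolutionOfSingularities.Theorems
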